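import Summits.HodgeConjecture.CorCM.MumfordTateRankTwoEndomorphism
import Summits.HodgeConjecture.CorCM.Model.CMAbelianVarietyRealisedHolds
import Literature.AlgebraicGeometry.ComplexMultiplication.PureTypeIsogenousPower
import Literature.AlgebraicGeometry.ComplexMultiplication.ShimuraIsogenousPowerOfRiemann
import Literature.AlgebraicGeometry.ComplexMultiplication.CMTorusImaginaryQuadratic
import Literature.AlgebraicGeometry.Pohlmann1968.SimpleCMAbelianVarietyHazamaCriterion
import Literature.AlgebraicGeometry.Milne1999.CMTypeSubquotients
import Literature.NumberTheory.ComplexMultiplication.CMTypeCount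
import HarnessLib

/-!
# The bottom of the Mumford–Tate rank ladder, II: `dim MT(H¹(X)) = 2` iff `X` is isogenous to a power of an
# elliptic curve with complex multiplication

COR-CM (cell `pub-hodgecm2`, seat `b27` gen 28, count-neutral lane MT-RANK-TWO, variety-level file 2 of 2;
theorems only, no definition, no named fact; UNCONDITIONAL).  For an ARBITRARY complex abelian variety `X` with
`0 < dim X` (no CM hypothesis):

* `exists_isCMTypeRealisation_of_mtRank_hodge_one_eq_two` / `exists_ellipticCurve_of_mtRank_hodge_one_eq_two` —
  **if `dim MT(H¹(X)) = 2` then `X` is isogenous to `E^{dim X}` for an elliptic curve `E` with complex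
  multiplication** (by the imaginary quadratic field `K = ℚ(x)`, `x` the endomorphism of file 1);
* `mtRank_hodge_one_eq_two_of_isIsogenous_powSucc` — conversely every `X` isogenous to a power of a CM elliptic
  curve has `dim MT(H¹(X)) = 2`;
* `mtRank_hodge_one_eq_two_iff` — the equivalence; `exists_ellipticCurve_of_mtRank_hodge_one_le_two` (with
  file 1's `2 ≤ dim MT(H¹(X))`); `three_le_mtRank_hodge_one_of_not_isOfCMType` (non-CM ⟹ `dim MT ≥ 3`);
  `isOfCMType_of_mtRank_hodge_one_eq_two`,
  `hodgeConjectureFor_powSucc_of_mtRank_hodge_one_eq_two` (such `X` are of CM type, stably nondegenerate, and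
  the Hodge conjecture holds on all their powers — by name from gen 27's criterion
  `hodgeConjectureFor_powSucc_of_mtRank_hodge_one_eq`).

## Proof (Shimura Thm. 24.15 through Riemann's theorem; folklore)

From file 1: `x² = c + d x` over `ℚ` with non-real eigenvalues `μ₀ = μ̄₁ ≠ μ₁`.  Then `P = X² − dX − c` has no
rational root, `K = ℚ[X]/(P)` (`AdjoinRoot P`) is an imaginary quadratic field (totally complex: every embedding
sends the root to `μ₀` or `μ₁`), hence a CM field (`CMTypeCount.isCMField_of_finrank_eq_two`), acting on
`H¹(X(ℂ); ℚ)` by `ρ : K → End`, `root ↦ x` (through the quotient `ℚ[X] → K`), and for the CM type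
`Φ = {σ | σ(root) = μ₁}` the joint `σ`-eigenvectors of the complexified action are purely of type `(1,0)` for
`σ ∈ Φ` and purely `(0,1)` otherwise — exactly the hypothesis of the tree's `exists_isIsogeny_power_of_pure`
(Shimura 1998 Thm. 24.15 from Riemann's theorem `deligneMilne1982_Thm_6_20_full_holds`), which makes `X` isogenous
to a product of copies of a realisation `E` of `(K; Φ)` (`cmAbelianVarietyRealised_holds`, Shimura §6.2 Thm. 3),
an elliptic curve (`[K:ℚ] = 2 dim E`).  Conversely `dim MT(H¹(E'^{N+1})) = Rank(Φ) = 2` for a realisation `E' ∼ E`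
(`mtRank_hodge_one_eq_cmFamilyRank_of_isIsogenous_biproduct`, `CMTorusImaginaryQuadratic.cmTypeRank_eq_two`).

## References

* [Shimura1998] G. Shimura, *Abelian Varieties with Complex Multiplication and Modular Functions* (1998), §24.15
  Theorem; §6.2 Theorem 3; §5.2.
* [DeligneMilne1982Tannakian] P. Deligne, J. S. Milne, *Tannakian Categories*, LNM 900 (1982), §6 Thm. 6.20.
* [Deligne1982HodgeCycles] P. Deligne, *Hodge cycles on abelian varieties*, LNM 900 (1982), I Ex. 3.7, §4–§5.
* [MoonenZarhin1999LowDim] B. Moonen, Yu. Zarhin, *Hodge classes on abelian varieties of low dimension*, Math.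
  Ann. 315 (1999), §2.
* [Gordon1999HodgeAVSurvey] B. B. Gordon, *A survey of the Hodge conjecture for abelian varieties* (1999), 7.5,
  7.6.1, 9.1.
-/

noncomputable section

open scoped TensorProduct
open CategoryTheory CategoryTheory.Limits NumberField Module Polynomial
open scoped BigOperators

namespace Summit.HodgeConjecture.CorCM

open Literature.NumberTheory.ComplexMultiplication
open Literature.AlgebraicGeometry.Motives
open Literature.AlgebraicGeometry.Motives.AbelianVariety
open Literature.AlgebraicGeometry.Motives.HodgeStructure
open Literature.AlgebraicGeometry.HodgeTheory
open Literature.AlgebraicGeometry.ComplexMultiplication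
open Literature.AlgebraicGeometry.Milne1999 (IsOfCMType isOfCMType_powSucc_iff isOfCMType_iff_of_isIsogenous)
open Literature.AlgebraicGeometry.Pohlmann1968
open Summit.HodgeConjecture.CorCM.AndreRiemann

/-! ## §3 `dim MT(H¹(X)) = 2` ⟹ `X ∼ E^{dim X}` for a CM elliptic curve `E` -/

section ToEllipticCurve

variable [HodgeTensorFacts.{0, 0}] {X : AbelianVariety ℂ} {n : ℕ}

omit [HodgeTensorFacts.{0, 0}] in
/-- Two distinct roots `μ₀ ≠ μ₁` of `z² = c + d z` exhaust its roots: `μ₀ + μ₁ = d`, `μ₀ μ₁ = -c`, and every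
root is `μ₀` or `μ₁`. [folklore] -/
private theorem root_dichotomy {c d μ₀ μ₁ : ℂ} (hne : μ₀ ≠ μ₁) (h0 : μ₀ * μ₀ = c + d * μ₀)
    (h1 : μ₁ * μ₁ = c + d * μ₁) {z : ℂ} (hz : z * z = c + d * z) : z = μ₀ ∨ z = μ₁ := by
  have hsum : μ₀ + μ₁ = d := by
    have h : (μ₀ - μ₁) * (μ₀ + μ₁ - d) = 0 := by linear_combination h0 - h1
    rcases mul_eq_zero.1 h with h | h
    · exact absurd (sub_eq_zero.1 h) hne
    · exact sub_eq_zero.1 h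
  have hprod : μ₀ * μ₁ = -c := by linear_combination μ₀ * hsum - h0
  have h : (z - μ₀) * (z - μ₁) = 0 := by linear_combination hz - z * hsum + hprod
  rcases mul_eq_zero.1 h with h | h
  · exact Or.inl (sub_eq_zero.1 h)
  · exact Or.inr (sub_eq_zero.1 h)

/-- **`dim MT(H¹(X)) = 2` ⟹ `X` is isogenous to a power of a CM elliptic curve — with the CM data.**  For a complex
abelian variety `X` with `0 < dim X` and `dim MT(H¹(X)) = 2` there are an imaginary quadratic field `K` (`[K:ℚ] = 2`,
a CM field), a CM type `Φ` of `K`, a realisation `(E, ι, θ)` of `(K; Φ)` — an elliptic curve with complex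
multiplication by `K` — and `m` with `dim X = m + 1` and `X` isogenous to `⨁_{Fin (m+1)} E = E^{dim X}`.
`K = ℚ[X]/(X² − dX − c)` for the quadratic relation of §2, acting on `H¹(X(ℂ); ℚ)` through `root ↦ x` with pure
eigenlines (`(1,0)` for `root ↦ μ₁`, `(0,1)` for `root ↦ μ₀`); Shimura's Thm. 24.15 in the tree's form
`exists_isIsogeny_power_of_pure` (from Riemann's theorem) gives the isogeny to a power of a realisation `E` of
`(K; {root ↦ μ₁})`, which exists by `cmAbelianVarietyRealised_holds` (Shimura §6.2 Thm. 3).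
[cite: Shimura1998, §24.15 Theorem and §6.2 Theorem 3] [cite: DeligneMilne1982Tannakian, §6 Thm. 6.20 (Riemann)]
[cite: Deligne1982HodgeCycles, I Ex. 3.7] -/
theorem exists_isCMTypeRealisation_of_mtRank_hodge_one_eq_two (hX : IsSmoothProjective n X.X) (h0 : 0 < X.dim)
    (h2 : haveI := BettiUniverse.finite hX 1
      (BettiUniverse.hodge exists_isReal_hodgeModel_holds hX 1).mtRank = 2) :
    ∃ (K : Type) (_ : Field K) (_ : NumberField K) (_ : IsCMField K) (Φ : CMType K) (E : AbelianVariety ℂ)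
      (ι : 𝓞 K →+* End E) (θ : K →+* Module.End ℂ (complexBetti E.X 1)) (m : ℕ),
      IsCMTypeRealisation Φ E ι θ ∧ Module.finrank ℚ K = 2 ∧ E.dim = 1 ∧ X.dim = m + 1 ∧
        IsIsogenous X (⨁ fun _ : Fin (m + 1) => E) := by
  have hn : X.dim = n := Literature.AlgebraicGeometry.Motives.schemeDim_eq_holds hX
  subst hn
  set V := bettiCohomology X.X 1
  obtain ⟨x, c, d, μ₀, μ₁, hxx, hne, hconj, hμ₀, hμ₁, hev, h10, h01⟩ :=
    exists_end_of_mtRank_hodge_one_eq_two hX h0 h2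
  -- the quadratic polynomial `P = X² - dX - c` and the field `K = ℚ[X]/(P)`
  set P : ℚ[X] := C 1 * Polynomial.X ^ 2 + C (-d) * Polynomial.X + C (-c) with hPdef
  have hP2 : P.natDegree = 2 := natDegree_quadratic one_ne_zero
  have hP0 : P ≠ 0 := fun h => by rw [h, natDegree_zero] at hP2; exact absurd hP2 (by norm_num)
  have hnoroot : ∀ r : ℚ, ¬ P.IsRoot r := by
    intro r hr
    have hr' : r * r = c + d * r := by
      have h : P.eval r = 0 := hr
      rw [hPdef] at h
      simp only [eval_add, eval_mul, eval_C, eval_pow, eval_X, one_mul, neg_mul] at h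
      linear_combination h
    have h : (r : ℂ) * r = c + d * r := by exact_mod_cast hr'
    have hreal : starRingEnd ℂ (r : ℂ) = r := map_ratCast (starRingEnd ℂ) r
    have hc0 : starRingEnd ℂ μ₀ = μ₁ := by rw [← hconj, Complex.conj_conj]
    rcases root_dichotomy hne hμ₀ hμ₁ h with h' | h'
    · exact hne (by rw [← hc0, ← h', hreal])
    · exact hne (by rw [← hconj, ← h', hreal])
  have hirr : Irreducible P :=
    irreducible_of_degree_le_three_of_not_isRoot (by rw [hP2]; decide) hnoroot
  haveI : Fact (Irreducible P) := ⟨hirr⟩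
  let K := AdjoinRoot P
  have hK2 : Module.finrank ℚ K = 2 := by
    rw [(AdjoinRoot.powerBasis hP0).finrank, AdjoinRoot.powerBasis_dim, hP2]
  -- every complex embedding sends the root to `μ₀` or `μ₁`
  have hemb : ∀ σ : K →+* ℂ, σ (AdjoinRoot.root P) = μ₀ ∨ σ (AdjoinRoot.root P) = μ₁ := by
    have hev2 : ∀ z : ℂ, eval₂ (algebraMap ℚ ℂ) z P = z * z - d * z - c := by
      intro z
      rw [hPdef]
      simp only [eval₂_add, eval₂_mul, eval₂_C, eval₂_X, eq_ratCast, Rat.cast_one, one_mul, Rat.cast_neg,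
        neg_mul, pow_two]
      ring
    intro σ
    have h1 := congrArg σ (AdjoinRoot.eval₂_root P)
    rw [Polynomial.hom_eval₂, map_zero, show σ.comp (AdjoinRoot.of P) = algebraMap ℚ ℂ from Subsingleton.elim _ _,
      hev2] at h1
    exact root_dichotomy hne hμ₀ hμ₁ (by linear_combination h1)
  have hμ₀nr : starRingEnd ℂ μ₀ ≠ μ₀ := by
    rw [show starRingEnd ℂ μ₀ = μ₁ by rw [← hconj, Complex.conj_conj]]
    exact hne.symm
  have hμ₁nr : starRingEnd ℂ μ₁ ≠ μ₁ := by rw [hconj]; exact hne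
  haveI : IsTotallyComplex K := ⟨fun v => InfinitePlace.not_isReal_iff_isComplex.1 fun hv => by
    have hr := ComplexEmbedding.isReal_iff.1 (InfinitePlace.isReal_iff.1 hv)
    have h := RingHom.congr_fun hr (AdjoinRoot.root P)
    rw [ComplexEmbedding.conjugate_coe_eq] at h
    rcases hemb v.embedding with h' | h' <;> rw [h'] at h
    exacts [hμ₀nr h, hμ₁nr h]⟩
  haveI : IsCMField K := CMTypeCount.isCMField_of_finrank_eq_two hK2
  -- the CM type `{σ | σ(root) = μ₁}`
  let Φ : CMType K := ⟨{σ | σ (AdjoinRoot.root P) = μ₁}, fun σ => by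
    simp only [Set.mem_setOf_eq, ComplexEmbedding.conjugate_coe_eq]
    constructor
    · intro h
      rw [h, hconj]
      exact hne
    · intro h
      rcases hemb σ with h' | h'
      · rw [h', show starRingEnd ℂ μ₀ = μ₁ by rw [← hconj, Complex.conj_conj]] at h
        exact absurd rfl h
      · exact h'⟩
  -- the action `ρ : K → End_ℚ H¹(X(ℂ); ℚ)`, `root ↦ x` (through the quotient `ℚ[X] → ℚ[X]/(P)`)
  have hPx : aeval x P = 0 := by
    rw [hPdef]
    simp only [map_add, map_mul, aeval_C, aeval_X, map_one, one_mul, map_neg, pow_two, hxx,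
      Algebra.algebraMap_eq_smul_one, neg_mul, smul_one_mul]
    abel
  have hker : ∀ q ∈ (Ideal.span {P} : Ideal ℚ[X]), (aeval x).toRingHom q = 0 := by
    intro q hq
    obtain ⟨r, rfl⟩ := Ideal.mem_span_singleton'.1 hq
    show aeval x (r * P) = 0
    rw [map_mul, hPx, mul_zero]
  let ρ₀ : K →+* Module.End ℚ V := Ideal.Quotient.lift (Ideal.span {P}) (aeval x).toRingHom hker
  have hρ₀ : ρ₀ (AdjoinRoot.root P) = x := by
    show Ideal.Quotient.lift (Ideal.span {P}) (aeval x).toRingHom hker (Ideal.Quotient.mk _ Polynomial.X) = x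
    rw [Ideal.Quotient.lift_mk]
    exact aeval_X x
  have hp : ∀ (σ : K →+* ℂ) (t : ℂ ⊗[ℚ] V), (∀ a : K, (ρ₀ a).baseChange ℂ t = (σ a : ℂ) • t) →
      (σ ∈ Φ.1 → IsOfHodgeType X.dim X.X 1 1 0 (ofRatClassBaseChange (ComplexPoints X.X) 1 t)) ∧
      (σ ∉ Φ.1 → IsOfHodgeType X.dim X.X 1 0 1 (ofRatClassBaseChange (ComplexPoints X.X) 1 t)) := by
    intro σ t ht
    have hxt : x.baseChange ℂ t = σ (AdjoinRoot.root P) • t := by rw [← hρ₀]; exact ht _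
    refine ⟨fun hσ => h10 t ?_, fun hσ => h01 t ?_⟩
    · have hσ' : σ (AdjoinRoot.root P) = μ₁ := hσ
      rw [hxt, hσ']
    · have hσ' : σ (AdjoinRoot.root P) ≠ μ₁ := hσ
      rw [hxt, (hemb σ).resolve_right hσ']
  -- a realisation `E` of `(K; Φ)` and Shimura 24.15
  obtain ⟨E, ιE, θE, hE⟩ := exists_isCMTypeRealisation_of_realised cmAbelianVarietyRealised_holds K Φ
  obtain ⟨m, P', π, ⟨hlim⟩, g, hg, -⟩ := exists_isIsogeny_power_of_pure hE hE.isInducedOnIntegers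
    (@RingHom.toRatAlgHom K (Module.End ℚ V) _ _ (_) (_) ρ₀) fun σ t ht => hp σ t fun a => ht a
  have hE1 : E.dim = 1 := by
    have h := Literature.AlgebraicGeometry.Pohlmann1968.finrank_eq_two_mul_dim_of_isCMTypeRealisation hE
    omega
  let iso : P' ≅ ⨁ (fun _ : Fin m => E) := hlim.conePointUniqueUpToIso (biproduct.isLimit _)
  have hXB : IsIsogenous X (⨁ fun _ : Fin m => E) := ⟨g ≫ iso.hom, isIsogeny_comp hg (isIsogeny_hom_of_iso iso)⟩
  have hm : X.dim = m := by
    rw [(dim_eq_of_isIsogenous_holds hXB : X.dim = _), dim_biproduct_fin]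
    simp [hE1]
  obtain ⟨k, rfl⟩ : ∃ k, m = k + 1 := ⟨m - 1, by omega⟩
  exact ⟨K, inferInstance, inferInstance, inferInstance, Φ, E, ιE, θE, k, hE, hK2, hE1, hm, hXB⟩

/-- **`dim MT(H¹(X)) = 2` ⟹ `X ∼ E^{dim X}` for an elliptic curve `E` with complex multiplication**
(`IsOfCMType E`, `dim E = 1`). [cite: Shimura1998, §24.15 Theorem] [cite: Deligne1982HodgeCycles, I Ex. 3.7]
[cite: MoonenZarhin1999LowDim, §2] -/
theorem exists_ellipticCurve_of_mtRank_hodge_one_eq_two (hX : IsSmoothProjective n X.X) (h0 : 0 < X.dim)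
    (h2 : haveI := BettiUniverse.finite hX 1
      (BettiUniverse.hodge exists_isReal_hodgeModel_holds hX 1).mtRank = 2) :
    ∃ E : AbelianVariety ℂ, E.dim = 1 ∧ IsOfCMType E ∧ IsIsogenous X (E.powSucc (X.dim - 1)) := by
  obtain ⟨K, _, _, _, Φ, E, ι, θ, m, hE, -, hE1, hm, hXB⟩ :=
    exists_isCMTypeRealisation_of_mtRank_hodge_one_eq_two hX h0 h2
  refine ⟨E, hE1, isOfCMType_of_isCMTypeRealisation hE, ?_⟩
  rw [hm, Nat.add_sub_cancel]
  exact hXB.trans (isIsogenous_powSucc_biproduct E m).symm'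

/-- **An abelian variety with `dim MT(H¹(X)) = 2` is of CM type** (it is isogenous to a power of a CM elliptic curve;
`IsOfCMType` is an isogeny invariant and stable under powers). [cite: MoonenZarhin1999LowDim, §2]
[cite: Milne1999LefschetzClasses, §1 Prop. 1.1] -/
theorem isOfCMType_of_mtRank_hodge_one_eq_two (hX : IsSmoothProjective n X.X) (h0 : 0 < X.dim)
    (h2 : haveI := BettiUniverse.finite hX 1
      (BettiUniverse.hodge exists_isReal_hodgeModel_holds hX 1).mtRank = 2) : IsOfCMType X := by
  obtain ⟨E, -, hEcm, hXE⟩ := exists_ellipticCurve_of_mtRank_hodge_one_eq_two hX h0 h2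
  exact (isOfCMType_iff_of_isIsogenous hXE).2 ((isOfCMType_powSucc_iff _).2 hEcm)

/-- **`dim MT(H¹(X)) = 2` ⟹ every power `X^{N+1}` is divisor-generated and satisfies the Hodge conjecture**,
unconditionally: `X ∼ E^{dim X}` with `E` a simple CM elliptic curve and `dim MT(H¹(X)) = dim E + 1`, so gen 27's
criterion `hodgeConjectureFor_powSucc_of_mtRank_hodge_one_eq` (Gordon 7.5 (3) ⟹ (1) on the variety) applies.
[cite: Gordon1999HodgeAVSurvey, 7.5] [cite: vanGeemen1994HodgeAV, Lemma 3.7 and Thm. 4.3] -/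
theorem hodgeConjectureFor_powSucc_of_mtRank_hodge_one_eq_two (hX : IsSmoothProjective n X.X) (h0 : 0 < X.dim)
    (h2 : haveI := BettiUniverse.finite hX 1
      (BettiUniverse.hodge exists_isReal_hodgeModel_holds hX 1).mtRank = 2) (N : ℕ) :
    IsDivisorGenerated (X.powSucc N) ∧ HodgeConjectureFor (X.powSucc N).dim (X.powSucc N).X := by
  obtain ⟨K, _, _, _, Φ, E, ι, θ, m, hE, -, hE1, -, hXB⟩ :=
    exists_isCMTypeRealisation_of_mtRank_hodge_one_eq_two hX h0 h2
  refine hodgeConjectureFor_powSucc_of_mtRank_hodge_one_eq (C := Unit) (K' := fun _ => K) (Φ' := fun _ => Φ)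
    (A' := fun _ => E) (ι' := fun _ => ι) (θ' := fun _ => θ) (cls := fun _ : Fin (m + 1) => ())
    (fun _ => hE) (fun _ => isSimple_of_dim_le_one hE1.le) (fun c c' h => absurd (Subsingleton.elim c c') h)
    (fun u => ⟨0, Subsingleton.elim _ _⟩) hX hXB ?_ N
  rw [h2]
  simp [hE1]

end ToEllipticCurve

/-! ## §4 The converse: powers of CM elliptic curves have `dim MT(H¹) = 2`; the equivalence -/

section Converse

variable [HodgeTensorFacts.{0, 0}] {X : AbelianVariety ℂ} {n : ℕ}

omit [HodgeTensorFacts.{0, 0}] in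
/-- The rank of a CONSTANT family `(Φ, …, Φ)` on a nonempty index set is the rank of `Φ` (the family type is
the preimage of `Φ` under the equivariant surjection `(i, s) ↦ s`; `typeRank_preimage_eq_of_surjective`).
[cite: Gordon1999HodgeAVSurvey, 7.6.1] -/
theorem cmFamilyRank_const_eq_cmTypeRank {I : Type} [Nonempty I] {K : Type} [Field K] [NumberField K]
    (Φ : CMType K) : CMAlgebra.cmFamilyRank (K := fun _ : I => K) (fun _ => Φ) = cmTypeRank Φ := by
  rw [CMAlgebra.cmFamilyRank_const]
  unfold Literature.AlgebraicGeometry.Pohlmann1968.cmFamilyRank cmTypeRank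
  have hset : Literature.AlgebraicGeometry.Pohlmann1968.familyType (fun _ : I => Φ) = (fun x : (_ : I) × (K →+* ℂ) => x.2) ⁻¹' Φ.1 := rfl
  rw [hset]
  exact typeRank_preimage_eq_of_surjective Φ.1 _ (fun g x => by obtain ⟨i, s⟩ := x; rfl)
    fun s => ⟨⟨Classical.arbitrary I, s⟩, rfl⟩

/-- **Powers of a CM elliptic curve have `dim MT(H¹) = 2`**: if `dim E = 1`, `E` is of CM type and `X` is isogenous
to `E^{N+1}`, then `dim MT(H¹(X)) = 2` — `E ∼ E'` a realisation of a CM type `Φ` of an imaginary quadratic `K`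
(`exists_realisation_mtRank_eq`), `X ∼ ⨁_{Fin (N+1)} E'`, `dim MT(H¹(X)) = cmFamilyRank (Φ, …, Φ) = Rank(Φ) = 2`
(`mtRank_hodge_one_eq_cmFamilyRank_of_isIsogenous_biproduct`, `CMTorusImaginaryQuadratic.cmTypeRank_eq_two`).
[cite: Deligne1982HodgeCycles, I Ex. 3.7 (c)] [cite: Gordon1999HodgeAVSurvey, 7.6.1 and 9.1] -/
theorem mtRank_hodge_one_eq_two_of_isIsogenous_powSucc (hX : IsSmoothProjective n X.X) {E : AbelianVariety ℂ}
    (hE1 : E.dim = 1) (hEcm : IsOfCMType E) {N : ℕ} (hXE : IsIsogenous X (E.powSucc N)) :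
    haveI := BettiUniverse.finite hX 1
    (BettiUniverse.hodge exists_isReal_hodgeModel_holds hX 1).mtRank = 2 := by
  obtain ⟨K, _, _, _, Φ, E', ι, θ, s₀, hA, hiso, hK, -, -⟩ :=
    exists_realisation_mtRank_eq (AbelianVariety.isSmoothProjective_holds (A := E))
      (isSimple_of_dim_le_one hE1.le) (by omega) hEcm
  rw [hE1, mul_one] at hK
  have hXB : IsIsogenous X (⨁ fun _ : Fin (N + 1) => E') :=
    hXE.trans ((isIsogenous_powSucc hiso N).trans (isIsogenous_powSucc_biproduct E' N))
  rw [mtRank_hodge_one_eq_cmFamilyRank_of_isIsogenous_biproduct (C := Unit) (K' := fun _ => K)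
      (Φ' := fun _ => Φ) (A' := fun _ => E') (ι' := fun _ => ι) (θ' := fun _ => θ) (cls := fun _ : Fin (N + 1) => ())
      (fun _ => hA) (fun u => ⟨0, Subsingleton.elim _ _⟩) hX hXB,
    cmFamilyRank_const_eq_cmTypeRank, CMTorusImaginaryQuadratic.cmTypeRank_eq_two hK]

/-- **THE EQUIVALENCE.**  For a complex abelian variety `X` with `0 < dim X`:
`dim MT(H¹(X)) = 2` **iff** `X` is isogenous to a power of an elliptic curve with complex multiplication.
(`dim MT(H¹(X)) ≥ 2` always, `two_le_mtRank_hodge_one`: this is the bottom rung of the Mumford–Tate rank ladder,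
attained exactly by the `E^g`, `E` CM.) [cite: Deligne1982HodgeCycles, I Ex. 3.7] [cite: Shimura1998, §24.15 Theorem]
[cite: MoonenZarhin1999LowDim, §2] -/
theorem mtRank_hodge_one_eq_two_iff (hX : IsSmoothProjective n X.X) (h0 : 0 < X.dim) :
    haveI := BettiUniverse.finite hX 1
    (BettiUniverse.hodge exists_isReal_hodgeModel_holds hX 1).mtRank = 2 ↔
      ∃ (E : AbelianVariety ℂ) (N : ℕ), E.dim = 1 ∧ IsOfCMType E ∧ IsIsogenous X (E.powSucc N) := by
  refine ⟨fun h2 => ?_, fun ⟨E, N, hE1, hEcm, hXE⟩ => mtRank_hodge_one_eq_two_of_isIsogenous_powSucc hX hE1 hEcm hXE⟩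
  obtain ⟨E, hE1, hEcm, hXE⟩ := exists_ellipticCurve_of_mtRank_hodge_one_eq_two hX h0 h2
  exact ⟨E, X.dim - 1, hE1, hEcm, hXE⟩

/-- **Trichotomy-free reading: `dim MT(H¹(X)) ≤ 2` already forces `X ∼ E^{dim X}` with `E` CM** (since
`dim MT(H¹(X)) ≥ 2`). [cite: Deligne1982HodgeCycles, I Prop. 3.4 and Ex. 3.7] -/
theorem exists_ellipticCurve_of_mtRank_hodge_one_le_two (hX : IsSmoothProjective n X.X) (h0 : 0 < X.dim)
    (h2 : haveI := BettiUniverse.finite hX 1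
      (BettiUniverse.hodge exists_isReal_hodgeModel_holds hX 1).mtRank ≤ 2) :
    ∃ E : AbelianVariety ℂ, E.dim = 1 ∧ IsOfCMType E ∧ IsIsogenous X (E.powSucc (X.dim - 1)) :=
  exists_ellipticCurve_of_mtRank_hodge_one_eq_two hX h0 (le_antisymm h2 (two_le_mtRank_hodge_one hX h0))

/-- **A complex abelian variety which is NOT of CM type has `dim MT(H¹(X)) ≥ 3`** (`0 < dim X`): rank `2` forces
`X ∼ E^{dim X}` with `E` CM, hence `X` of CM type. [cite: MoonenZarhin1999LowDim, §2]
[cite: Deligne1982HodgeCycles, I Ex. 3.7] -/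
theorem three_le_mtRank_hodge_one_of_not_isOfCMType (hX : IsSmoothProjective n X.X) (h0 : 0 < X.dim)
    (hcm : ¬ IsOfCMType X) :
    haveI := BettiUniverse.finite hX 1
    3 ≤ (BettiUniverse.hodge exists_isReal_hodgeModel_holds hX 1).mtRank := by
  by_contra h
  have h2 := two_le_mtRank_hodge_one hX h0
  exact hcm (isOfCMType_of_mtRank_hodge_one_eq_two hX h0 (by omega))

end Converse

/-! ## §5 Instance-free and class-target forms (`Ring2.ClassTargets.HCOnClass`) -/

section ClassTargets

open Summit.HodgeConjecture.HodgeConjecture.Ring2.ClassTargets (HCOnClass)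

variable {X : AbelianVariety ℂ} {n : ℕ}

/-- Instance-free form (the tensor facts discharged by `hodgeTensorFacts_holds`): **`dim MT(H¹(X)) ≤ 2` ⟹ every power
`X^{N+1}` is divisor-generated and satisfies the Hodge conjecture.** [cite: Gordon1999HodgeAVSurvey, 7.5]
[cite: vanGeemen1994HodgeAV, Lemma 3.7 and Thm. 4.3] -/
theorem hodgeConjectureFor_powSucc_of_mtRank_hodge_one_le_two' (hX : IsSmoothProjective n X.X) (h0 : 0 < X.dim)
    (h2 : haveI := BettiUniverse.finite hX 1
      @HodgeStructure.mtRank _ _ _ hodgeTensorFacts_holds.{0, 0} _ _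
        (BettiUniverse.hodge exists_isReal_hodgeModel_holds hX 1) ≤ 2) (N : ℕ) :
    IsDivisorGenerated (X.powSucc N) ∧ HodgeConjectureFor (X.powSucc N).dim (X.powSucc N).X := by
  haveI : HodgeTensorFacts.{0, 0} := hodgeTensorFacts_holds.{0, 0}
  exact hodgeConjectureFor_powSucc_of_mtRank_hodge_one_eq_two hX h0
    (le_antisymm h2 (two_le_mtRank_hodge_one hX h0)) N

/-- **Class-target display**: the Hodge conjecture holds on the class of complex abelian varieties `B` with
`0 < dim B` and `dim MT(H¹(B)) ≤ 2` (= the abelian varieties isogenous to a power of a CM elliptic curve) —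
UNCONDITIONAL. [cite: Gordon1999HodgeAVSurvey, 7.5 and 10.10] [cite: Deligne2000, §1] -/
theorem hcOnClass_mtRank_hodge_one_le_two :
    HCOnClass fun B => 0 < B.dim ∧
      @HodgeStructure.mtRank _ _ _ hodgeTensorFacts_holds.{0, 0}
          (BettiUniverse.finite (AbelianVariety.isSmoothProjective_holds (A := B)) 1) _
          (BettiUniverse.hodge exists_isReal_hodgeModel_holds (AbelianVariety.isSmoothProjective_holds (A := B)) 1) ≤ 2 :=
  fun _ ⟨h0, h2⟩ =>
    (hodgeConjectureFor_powSucc_of_mtRank_hodge_one_le_two' AbelianVariety.isSmoothProjective_holds h0 h2 0).2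

end ClassTargets

end Summit.HodgeConjecture.CorCM

end
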